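import Summits.QuantumFields.YangMills.Theses.ConvexGribovBody
import Literature.MathematicalPhysics.QuantumFieldTheory.LatticeGaugeProofs
import Literature.MathematicalPhysics.QuantumFieldTheory.ConstructiveQFTWave0Proofs

/-!
# Time-reflection invariance of Wilson's torus measure
(crux `ConvexGribovBody.PoincareToGap`, line `Sketch`, stub G2)

TIME-REVERSAL SYMMETRY of Wilson's lattice gauge measure on the torus `(ℤ/L)^d`: for a compact
group `G` with a continuous unitary matrix representation `r`, every real `β`, and the
Osterwalder–Seiler reflection `Θ = GaugeConfig.timeReflect` on configurations (`θ t = 1 - t` on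
sites; spatial links are carried along, the temporal link `x → x + e₀` goes to the reversed
temporal link `θ(x + e₀) → θx`, whence an inverse),
* `(wilsonMeasure r.ρ β).map Θ = wilsonMeasure r.ρ β`, and consequently
* `∫ f (Θ U) dμ_{Λ,β}(U) = ∫ f U dμ_{Λ,β}(U)` for every `f : GaugeConfig d L G → ℝ`.

Proof.  `Θ` is an involution on configurations (`timeReflect_involutive`: on links it is the
involution `WilsonRP.edgeReflect` followed by inversion of the temporal variables), and it is
measurable (`WilsonRP.measurable_timeReflect`), so it is a measurable equivalence which is its
own inverse.  It preserves the product Haar measure (`WilsonRP.measurePreserving_timeReflect`: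
relabelling of the links and inversion invariance of Haar measure on the compact group) and the
Wilson action (`wilsonAction_timeReflect`: by `WilsonRP.plaqRe_timeReflect`,
`Re tr ρ((ΘU)_p) = Re tr ρ(U_{ϑp})` for the involution `ϑ = WilsonRP.plaqReflect` of the
plaquettes, so the plaquette sum is re-indexed).  Hence it preserves the density
`exp(-β S)` times product Haar measure (`withDensity_map_of_measurableEquiv`) and its
normalisation `wilsonMeasure`.  The integral form is the change of variables under a measurable
equivalence (`MeasureTheory.integral_map_equiv`).

References: K. Osterwalder, E. Seiler, Ann. Phys. 110 (1978) 440, §2; E. Seiler, LNP 159 (1982),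
Ch. 2 (the Wilson action and the product Haar measure are invariant under time reflection).
[folklore]
-/

noncomputable section

open scoped BigOperators Topology
open MeasureTheory Filter
open Literature.MathematicalPhysics.QuantumFieldTheory

namespace Summit.QuantumFields.YangMills.Theorems.PoincareToGap

/-- The Osterwalder–Seiler time reflection `Θ` on torus gauge configurations is an involution:
`Θ (Θ U) = U`.  On links `Θ` is the involution `edgeReflect` (`WilsonRP.edgeReflect_edgeReflect`)
followed by inversion of the temporal link variables. [folklore] -/
theorem timeReflect_involutive {G : Type*} [Group G] {d L : ℕ} [NeZero d] :
    Function.Involutive (GaugeConfig.timeReflect : GaugeConfig d L G → GaugeConfig d L G) := by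
  intro U
  funext e
  obtain ⟨x, i⟩ := e
  by_cases hi : i = 0
  · subst hi
    simp [GaugeConfig.timeReflect]
  · simp [GaugeConfig.timeReflect, hi]

/-- The Wilson action is invariant under the time reflection `Θ`: `S(ΘU) = S(U)`.  Indeed
`Re tr ρ((ΘU)_p) = Re tr ρ(U_{ϑp})` (`WilsonRP.plaqRe_timeReflect`) for the involution
`ϑ = WilsonRP.plaqReflect` of the plaquettes, and the plaquette sum is re-indexed by `ϑ`.
[folklore] -/
theorem wilsonAction_timeReflect {G : Type*} [Group G] [TopologicalSpace G] [IsTopologicalGroup G]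
    [CompactSpace G] {d L N : ℕ} [NeZero d] [NeZero L] (ρ : G →* Matrix (Fin N) (Fin N) ℂ)
    (hρ : Continuous ρ) (U : GaugeConfig d L G) :
    wilsonAction ρ U.timeReflect = wilsonAction ρ U := by
  rw [WilsonRP.wilsonAction_eq, WilsonRP.wilsonAction_eq]
  congr 1
  simp_rw [WilsonRP.plaqRe_timeReflect ρ hρ]
  exact Fintype.sum_equiv WilsonRP.plaqReflectEquiv _ _ fun p => rfl

/-- The time reflection `Θ` is (the forward map of) a measurable equivalence of the configuration
space. [folklore] -/
theorem exists_measurableEquiv_coe_eq_timeReflect {G : Type*} [Group G] [TopologicalSpace G]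
    [IsTopologicalGroup G] [MeasurableSpace G] [BorelSpace G] {d L : ℕ} [NeZero d] :
    ∃ Θ : GaugeConfig d L G ≃ᵐ GaugeConfig d L G,
      (⇑Θ : GaugeConfig d L G → GaugeConfig d L G) = GaugeConfig.timeReflect :=
  ⟨{ toEquiv := timeReflect_involutive.toPerm _
     measurable_toFun := WilsonRP.measurable_timeReflect
     measurable_invFun := WilsonRP.measurable_timeReflect }, rfl⟩

/-- **G2: time-reversal symmetry — Wilson's torus measure is invariant under the
Osterwalder–Seiler time reflection.**  For every `d, L ≥ 1`, every compact group `G` with lattice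
representation data `r` and every real `β`, the push-forward of `wilsonMeasure r.ρ β` under
`Θ = GaugeConfig.timeReflect` is `wilsonMeasure r.ρ β`, and consequently
`∫ f (Θ U) dμ(U) = ∫ f U dμ(U)` for every real observable `f` (no measurability needed: `Θ` is a
measurable equivalence).  `Θ` preserves the product Haar measure
(`WilsonRP.measurePreserving_timeReflect`) and the Wilson action (`wilsonAction_timeReflect`).
[folklore] -/
theorem stub_wilsonMeasure_timeReflect_invariant :
    ∀ (G : Type) [Group G] [TopologicalSpace G] [IsTopologicalGroup G] [CompactSpace G]
      [MeasurableSpace G] [BorelSpace G] (r : LatticeRep G) (β : ℝ) (d L : ℕ) [NeZero d] [NeZero L],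
    (wilsonMeasure r.ρ β : Measure (GaugeConfig d L G)).map GaugeConfig.timeReflect =
        (wilsonMeasure r.ρ β : Measure (GaugeConfig d L G)) ∧
      ∀ f : GaugeConfig d L G → ℝ,
        ∫ U, f U.timeReflect ∂(wilsonMeasure r.ρ β : Measure (GaugeConfig d L G)) =
          ∫ U, f U ∂(wilsonMeasure r.ρ β : Measure (GaugeConfig d L G)) := by
  intro G _ _ _ _ _ _ r β d L _ _
  obtain ⟨Θ, hΘ⟩ := exists_measurableEquiv_coe_eq_timeReflect (G := G) (d := d) (L := L)
  have hmap : (wilsonMeasure r.ρ β : Measure (GaugeConfig d L G)).map GaugeConfig.timeReflect =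
      (wilsonMeasure r.ρ β : Measure (GaugeConfig d L G)) := by
    have hπ : (Measure.pi fun _ : Edge d L => haarProbability G).map (⇑Θ) =
        Measure.pi fun _ : Edge d L => haarProbability G := by
      rw [hΘ]
      exact (WilsonRP.measurePreserving_timeReflect (d := d) (L := L) (G := G)).map_eq
    rw [← hΘ]
    simp only [wilsonMeasure, Measure.map_smul, wilsonWeight]
    rw [withDensity_map_of_measurableEquiv _ _ _ hπ]
    intro U
    rw [hΘ, wilsonAction_timeReflect r.ρ r.continuous]
  refine ⟨hmap, fun f => ?_⟩
  have h := integral_map_equiv (μ := (wilsonMeasure r.ρ β : Measure (GaugeConfig d L G))) Θ f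
  rw [hΘ, hmap] at h
  exact h.symm

end Summit.QuantumFields.YangMills.Theorems.PoincareToGap

end
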